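import Literature.Probability.FitznerVanDerHofstad2017.SimpleDiagramFourierBound
import Literature.Probability.FitznerVanDerHofstad2017.NbwRemainderKernel
import Literature.Probability.FitznerVanDerHofstad2017.TrailCounts
import HarnessLib

/-!
# The N53 frame theorem: the trail remainder `((a_{c₁} ⋆ ⋯ ⋆ a_{c_n}) ⋆ τ_p^{⋆n})(x)` is bounded by
# `Γ̄₂ⁿ · J_n(∏ P_{cᵢ})` (b2b-lace, LEMMAS §20 node N68c-A)

Build `lace`, packet node N68c-A (explicit-unit carver).  Everything in this module is a kernel fact
about the tree's OWN objects — the trail / non-backtracking word counts `trailWordsTo`, `nbwWordsTo`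
(`TrailCounts.lean`, `NonBacktrackingPathCounting.lean`), the convolution algebra `latticeConv`,
`convPow`, `srwStep`, the percolation two-point function `tau`, the bootstrap quantity
`nobleSup2 d p = Γ̄₂ = sup_k [1-D̂(k)]|τ̂_p(k)|` and the polynomial-kernel integral `nbwJ`
(`NbwRemainderKernel.lean`).  The statements are elementary consequences of the general
symmetric-kernel Fourier bound `kernelConvTau_le_nobleSup2_pow_mul_integral(')` of
`SimpleDiagramFourierBound.lean` and are tagged with the printed display they instantiate; they are
programme-internal (a bound VARIANT, not a display of the papers) and NOT citable as literature; no
literal of any certificate is produced or consumed here.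

CONTEXT (provenance only; nothing below is used as a hypothesis).  [NoBLE17-I] = R. Fitzner,
R. van der Hofstad, *Generalized approach to the non-backtracking lace expansion*, PTRF 169 (2017)
1041–1119, arXiv:1506.07969: §5.3.1–5.3.2, (5.22)–(5.27) (TeX l.3085–3165) bound the "long" remainder
of a (repulsive) simple diagram through the trail counts `a_m(y)` = number of `m`-step walks `0 → y`
never using a bond twice, then `a_m ≤ (2d)^m D^{⋆m}` and the SRW integral `K_{n,M}`:
`Rem ≤ (2d)^M (D^{⋆M} ⋆ G_z^{⋆n})(x) ≤ (2d)^M Γ̄₂ⁿ K_{n,M}(x)` ((5.25) lines 2–3; §5.3.2 first display,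
p. 1097 — the tree's `srwConvTau_le_nobleSup2_pow_mul_srwK`).  [FvdH17] = R. Fitzner, R. van der
Hofstad, EJP 22 (2017) no. 43, arXiv:1506.07977, §4.2 (4.9)–(4.11), (4.18)–(4.21) is the percolation
instance (`G_z = τ_p`).  The programme's N53 variant keeps the whole printed derivation and replaces
ONLY the last step: trails are non-backtracking, `a_m ≤ b_m` (`card_trailWordsTo_le_card_nbwWordsTo`),
and for a kernel `f` with `f̂ = Q(2dD̂)` the general bound gives `Γ̄₂ⁿ ∫ |Q(2dD̂)| Ĉⁿ dk/(2π)^d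
= Γ̄₂ⁿ · nbwJ d n Q`.  This module DEFINES the quantity at which the two chains part — the trail
remainder `trailRem d p c x` — and the validity predicate `IsRemKernelConst d c X R`
("`R` bounds the trail remainder of composition `c` on the endpoint set `X`, up to `Γ̄₂ⁿ`"), and
PROVES that the N53 constants are valid: `isRemKernelConst_nbwJ` (x-uniform kernel, every `x`) and
`isRemKernelConst_nbwJ_single` (the `e₁` kernel `Q·X/(2d)`, at the unit vectors `eᵢ`), for every
polynomial family `Q` realising the NBW counts in `x`-space (`nbwLaw d m = polyLaw d (Q m)`; the
tree's NBW polynomials discharge this hypothesis — module `NbwLawFourier`, not imported here so that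
this file elaborates against built modules only).  NOT here: the x-space extraction of the diagrams
((4.18), (5.22)–(5.27)) and any Stage-1 cell; the min with the printed constant is `IsRemKernelConst.min`.
-/

noncomputable section

namespace Literature.Probability.FitznerVanDerHofstad2017

open MeasureTheory Real Finset Filter
open scoped BigOperators
open Literature.Probability.LatticeModels
open Literature.Probability.Percolation
open Literature.Barriers.CriticalPhenomena
open Literature.Barriers.CriticalPhenomena.SpreadOutIsing (delta0 latticeConv convPow latticeConv_comm
  isZdSymmetric_latticeConv isZdSymmetric_convPow isZdSymmetric_delta0 isZdSymmetric_srwStep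
  delta0_nonneg)
open Literature.Barriers.CriticalPhenomena.Slade2006Prop53 (P)

variable {d : ℕ}

/-! ### Polynomial kernels in `x`-space: `polyLaw d Q = Σᵢ [Q]ᵢ (2d)^i D^{⋆i}`, `(polyLaw Q)^ = Q(2dD̂)` -/

/-- The `x`-space law of a polynomial kernel `Q(2dD̂)`: `polyLaw d Q = Σ_{i ≤ deg Q} [Q]ᵢ (2d)^i D^{⋆i}`.
[cite: FitznerVanDerHofstad2016NoBLE, (3.34)–(3.36) p. 1071] -/
def polyLaw (d : ℕ) (Q : Polynomial ℝ) (y : Site d) : ℝ :=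
  ∑ i ∈ Finset.range (Q.natDegree + 1), Q.coeff i * (2 * (d : ℝ)) ^ i * convPow (srwStep d) i y

/-- `polyLaw d Q` is summable (a finite combination of the summable `D^{⋆i}`). [folklore] -/
theorem summable_polyLaw (Q : Polynomial ℝ) : Summable (polyLaw d Q) := by
  unfold polyLaw
  exact summable_sum fun i _ => (summable_convPow_srwStep i).mul_left _

/-- `polyLaw d Q` is invariant under the signed coordinate permutations. [cite: FitznerVanDerHofstad2016NoBLE, Def. 2.5 p. 1058] -/
theorem isZdSymmetric_polyLaw (Q : Polynomial ℝ) : IsZdSymmetric (polyLaw d Q) := by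
  intro σ ε x
  unfold polyLaw
  exact Finset.sum_congr rfl fun i _ => by rw [isZdSymmetric_convPow isZdSymmetric_srwStep i σ ε x]

/-- **`(polyLaw d Q)^(k) = Q(2d·D̂(k))`** (linearity of the transform and `(D^{⋆i})^ = D̂^i`).
[cite: HeydenreichVanDerHofstad2017, (2.2.9)–(2.2.11)] -/
theorem cosFT_polyLaw (hd : 1 ≤ d) (Q : Polynomial ℝ) (k : Fin d → ℝ) :
    cosFT (polyLaw d Q) k = Q.eval (2 * (d : ℝ) * Dhat d k) := by
  classical
  have hsm : ∀ i ∈ Finset.range (Q.natDegree + 1), Summable fun y : Site d =>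
      Real.cos (kdot k y) * (Q.coeff i * (2 * (d : ℝ)) ^ i * convPow (srwStep d) i y) :=
    fun i _ => summable_cos_kdot_mul ((summable_convPow_srwStep i).mul_left _) k
  have hterm : ∀ i, ∑' y : Site d,
      Real.cos (kdot k y) * (Q.coeff i * (2 * (d : ℝ)) ^ i * convPow (srwStep d) i y)
        = Q.coeff i * (2 * (d : ℝ) * Dhat d k) ^ i := by
    intro i
    have h1 : (fun y : Site d =>
        Real.cos (kdot k y) * (Q.coeff i * (2 * (d : ℝ)) ^ i * convPow (srwStep d) i y))
          = fun y => (Q.coeff i * (2 * (d : ℝ)) ^ i) * (Real.cos (kdot k y) * convPow (srwStep d) i y) := by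
      funext y; ring
    have h2 : ∑' y : Site d, Real.cos (kdot k y) * convPow (srwStep d) i y = Dhat d k ^ i :=
      cosFT_convPow_srwStep hd i k
    rw [h1, tsum_mul_left, h2]
    ring
  have hswap : (∑' y : Site d, ∑ i ∈ Finset.range (Q.natDegree + 1),
        Real.cos (kdot k y) * (Q.coeff i * (2 * (d : ℝ)) ^ i * convPow (srwStep d) i y))
      = ∑ i ∈ Finset.range (Q.natDegree + 1), ∑' y : Site d,
        Real.cos (kdot k y) * (Q.coeff i * (2 * (d : ℝ)) ^ i * convPow (srwStep d) i y) := by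
    exact Summable.tsum_finsetSum hsm
  unfold cosFT polyLaw
  simp_rw [Finset.mul_sum]
  rw [hswap]
  simp_rw [hterm]
  rw [Polynomial.eval_eq_sum_range]

/-! ### Convolution of pieces `f c₁ ⋆ ⋯ ⋆ f c_n` -/

/-- The convolution `f c₁ ⋆ (f c₂ ⋆ (⋯ ⋆ (f c_n ⋆ δ₀)))` of the pieces of a composition `c`.
[cite: FitznerVanDerHofstad2016NoBLE, (5.25) p. 1097] -/
def pieces (f : ℕ → Site d → ℝ) : List ℕ → Site d → ℝ
  | [] => delta0
  | m :: c => latticeConv (f m) (pieces f c)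

section Pieces

variable {f g : ℕ → Site d → ℝ}

/-- Unfolding on the empty composition. [folklore] -/
@[simp] theorem pieces_nil : pieces f [] = (delta0 : Site d → ℝ) := rfl

/-- Unfolding on `m :: c`. [folklore] -/
@[simp] theorem pieces_cons (m : ℕ) (c : List ℕ) :
    pieces f (m :: c) = latticeConv (f m) (pieces f c) := rfl

/-- Non-negativity of the pieces' convolution. [folklore] -/
theorem pieces_nonneg (hf : ∀ m y, 0 ≤ f m y) : ∀ (c : List ℕ) (y : Site d), 0 ≤ pieces f c y
  | [], y => delta0_nonneg y
  | m :: c, y => latticeConv_nonneg (hf m) (pieces_nonneg hf c) y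

/-- Summability of the pieces' convolution. [folklore] -/
theorem summable_pieces (hf : ∀ m, Summable (f m)) : ∀ c : List ℕ, Summable (pieces f c)
  | [] => hasSum_delta0.summable
  | m :: c => summable_latticeConv_of_summable (hf m) (summable_pieces hf c)

/-- `W_d`-invariance of the pieces' convolution. [cite: FitznerVanDerHofstad2016NoBLE, Def. 2.5 p. 1058] -/
theorem isZdSymmetric_pieces (hf : ∀ m, IsZdSymmetric (f m)) : ∀ c : List ℕ, IsZdSymmetric (pieces f c)
  | [] => isZdSymmetric_delta0
  | m :: c => isZdSymmetric_latticeConv (hf m) (isZdSymmetric_pieces hf c)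

/-- **Convolution theorem for the pieces**: `(f c₁ ⋆ ⋯ ⋆ f c_n)^ = ∏ᵢ (f cᵢ)^`.
[cite: HeydenreichVanDerHofstad2017, (1.2.16)–(1.2.17)] -/
theorem cosFT_pieces (hf : ∀ m, Summable (f m)) (hW : ∀ m, IsZdSymmetric (f m)) (k : Fin d → ℝ) :
    ∀ c : List ℕ, cosFT (pieces f c) k = (c.map fun m => cosFT (f m) k).prod
  | [] => by rw [pieces_nil, cosFT_delta0, List.map_nil, List.prod_nil]
  | m :: c => by
    rw [pieces_cons, cosFT_latticeConv (hf m) (summable_pieces hf c)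
      (fun x => (isZdSymmetric_pieces hW c).neg x), cosFT_pieces hf hW k c, List.map_cons, List.prod_cons]

/-- Monotonicity of the pieces' convolution in the (non-negative) pieces. [folklore] -/
theorem pieces_mono (hf0 : ∀ m y, 0 ≤ f m y) (hfg : ∀ m y, f m y ≤ g m y) (hg : ∀ m, Summable (g m)) :
    ∀ (c : List ℕ) (y : Site d), pieces f c y ≤ pieces g c y
  | [], _ => le_rfl
  | m :: c, y => latticeConv_mono (hg m) (summable_pieces hg c) (hf0 m) (pieces_nonneg hf0 c)
      (hfg m) (pieces_mono hf0 hfg hg c) y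

end Pieces

/-! ### Trail and NBW counts as `x`-space functions; the trail remainder and the validity predicate -/

/-- `a_m(y)` = number of `m`-step trails `0 → y` (walks never using a bond twice), as a real function.
[cite: FitznerVanDerHofstad2016NoBLE, §5.3.1 p. 1096] -/
def trailLaw (d m : ℕ) (y : Site d) : ℝ := ((trailWordsTo d m y).card : ℝ)

/-- `b_m(y)` = number of `m`-step non-backtracking walks `0 → y`, as a real function.
[cite: MadrasSlade1993, §1.2 (memory-2 walks); Thm 5.3.1] -/
def nbwLaw (d m : ℕ) (y : Site d) : ℝ := ((nbwWordsTo d m y).card : ℝ)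

/-- `a_m ≥ 0`. [folklore] -/
theorem trailLaw_nonneg (m : ℕ) (y : Site d) : 0 ≤ trailLaw d m y := Nat.cast_nonneg _

/-- **`a_m(y) ≤ b_m(y)`**: trails are non-backtracking. [cite: MadrasSlade1993, §1.2] -/
theorem trailLaw_le_nbwLaw (m : ℕ) (y : Site d) : trailLaw d m y ≤ nbwLaw d m y := by
  unfold trailLaw nbwLaw
  exact_mod_cast card_trailWordsTo_le_card_nbwWordsTo d m y

/-- **THE TRAIL REMAINDER** `Rem_c(p;x) = ((a_{c₁} ⋆ ⋯ ⋆ a_{c_n}) ⋆ τ_p^{⋆n})(x)`, `n = |c|` pieces: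
the quantity through which the printed remainder chain ((5.25) line 2 → 3: `a_m ≤ (2d)^m D^{⋆m}`,
then `K_{n,M}`) and the N53 chain (`a_m ≤ b_m`, then `J_n`) both pass, and after which they differ.
[cite: FitznerVanDerHofstad2016NoBLE, (5.25) p. 1097] -/
def trailRem (d : ℕ) (p : unitInterval) (c : List ℕ) : Site d → ℝ :=
  latticeConv (pieces (trailLaw d) c) (convPow (tau d p 0) c.length)

/-- **Validity of a remainder-kernel constant**: `R` is valid for the composition `c` on the endpoint
set `X` iff `Rem_c(p;x) ≤ Γ̄₂(p)ⁿ · R` for every subcritical `p` and every `x ∈ X`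
(`Γ̄₂(p) = nobleSup2 d p`; under `f₂(p) ≤ Γ₂` it is `≤ (2d-2)/(2d-1)·Γ₂`, `nobleSup2_le_of_nobleF2_le`).
[cite: FitznerVanDerHofstad2016NoBLE, §5.3.2 (first display) p. 1097] -/
def IsRemKernelConst (d : ℕ) (c : List ℕ) (X : Set (Site d)) (R : ℝ) : Prop :=
  ∀ p : unitInterval, p < criticalProbI d → ∀ x ∈ X,
    trailRem d p c x ≤ nobleSup2 d p ^ c.length * R

/-- The `min` of two valid constants is valid (the licence for `min(notebook read, NBW read)`). [folklore] -/
theorem IsRemKernelConst.min {c : List ℕ} {X : Set (Site d)} {R₁ R₂ : ℝ}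
    (h₁ : IsRemKernelConst d c X R₁) (h₂ : IsRemKernelConst d c X R₂) :
    IsRemKernelConst d c X (min R₁ R₂) := by
  intro p hp x hx
  rcases min_choice R₁ R₂ with h | h <;> rw [h]
  · exact h₁ p hp x hx
  · exact h₂ p hp x hx

/-- Validity is inherited by smaller endpoint sets. [folklore] -/
theorem IsRemKernelConst.mono {c : List ℕ} {X Y : Set (Site d)} {R : ℝ}
    (h : IsRemKernelConst d c X R) (hYX : Y ⊆ X) : IsRemKernelConst d c Y R :=
  fun p hp x hx => h p hp x (hYX hx)

/-- A valid constant stays valid when enlarged. [folklore] -/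
theorem IsRemKernelConst.of_le {c : List ℕ} {X : Set (Site d)} {R R' : ℝ}
    (h : IsRemKernelConst d c X R) (hRR' : R ≤ R') : IsRemKernelConst d c X R' :=
  fun p hp x hx => (h p hp x hx).trans
    (mul_le_mul_of_nonneg_left hRR' (pow_nonneg (nobleSup2_nonneg' p) _))

/-- Unfolding a valid constant with the printed bootstrap factor: `f₂(p) ≤ Γ₂` and `0 ≤ R` give
`Rem_c(p;x) ≤ ((2d-2)/(2d-1)·Γ₂)ⁿ · R`. [cite: FitznerVanDerHofstad2016NoBLE, §5.3.2 (first display) p. 1097] -/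
theorem IsRemKernelConst.le_of_nobleF2_le {c : List ℕ} {X : Set (Site d)} {R : ℝ}
    (h : IsRemKernelConst d c X R) (hR : 0 ≤ R) (hd : 2 ≤ d) (p : unitInterval)
    (hp : p < criticalProbI d) {Γ₂ : ℝ} (hΓ : nobleF2 d p ≤ Γ₂) {x : Site d} (hx : x ∈ X) :
    trailRem d p c x ≤ ((2 * d - 2) / (2 * d - 1) * Γ₂) ^ c.length * R :=
  (h p hp x hx).trans (mul_le_mul_of_nonneg_right
    (pow_le_pow_left₀ (nobleSup2_nonneg' p) (nobleSup2_le_of_nobleF2_le hd p hΓ) _) hR)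

/-! ### The frame theorem -/

section Frame

variable (Q : ℕ → Polynomial ℝ)

/-- Under `b_m = polyLaw (Q m)`: `b_m` is summable. [folklore] -/
theorem summable_nbwLaw_of (hQ : ∀ m (y : Site d), nbwLaw d m y = polyLaw d (Q m) y) (m : ℕ) :
    Summable (nbwLaw d m) := by
  rw [show nbwLaw d m = polyLaw d (Q m) from funext (hQ m)]
  exact summable_polyLaw _

/-- Under `b_m = polyLaw (Q m)`: `b_m` is `W_d`-invariant. [folklore] -/
theorem isZdSymmetric_nbwLaw_of (hQ : ∀ m (y : Site d), nbwLaw d m y = polyLaw d (Q m) y) (m : ℕ) :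
    IsZdSymmetric (nbwLaw d m) := by
  rw [show nbwLaw d m = polyLaw d (Q m) from funext (hQ m)]
  exact isZdSymmetric_polyLaw _

/-- Under `b_m = polyLaw (Q m)`: `(b_{c₁} ⋆ ⋯ ⋆ b_{c_n})^(k) = (∏ᵢ Q cᵢ)(2dD̂(k))`.
[cite: HeydenreichVanDerHofstad2017, (1.2.16)–(1.2.17)] -/
theorem cosFT_pieces_nbwLaw_of (hQ : ∀ m (y : Site d), nbwLaw d m y = polyLaw d (Q m) y)
    (hd : 1 ≤ d) (c : List ℕ) (k : Fin d → ℝ) :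
    cosFT (pieces (nbwLaw d) c) k = ((c.map Q).prod).eval (2 * (d : ℝ) * Dhat d k) := by
  rw [cosFT_pieces (summable_nbwLaw_of Q hQ) (isZdSymmetric_nbwLaw_of Q hQ) k c,
    Polynomial.eval_list_prod, List.map_map]
  congr 1
  refine List.map_congr_left fun m _ => ?_
  show cosFT (nbwLaw d m) k = Polynomial.eval (2 * (d : ℝ) * Dhat d k) (Q m)
  rw [show nbwLaw d m = polyLaw d (Q m) from funext (hQ m), cosFT_polyLaw hd]

/-- Step 1 (x-space): `Rem_c(p;x) ≤ ((b_{c₁} ⋆ ⋯ ⋆ b_{c_n}) ⋆ τ_p^{⋆n})(x)` — trails are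
non-backtracking and everything is non-negative. [cite: MadrasSlade1993, §1.2] -/
theorem trailRem_le_nbwConvTau (hQ : ∀ m (y : Site d), nbwLaw d m y = polyLaw d (Q m) y)
    (hd : 2 ≤ d) (p : unitInterval) (hp : p < criticalProbI d) (c : List ℕ) (x : Site d) :
    trailRem d p c x ≤ latticeConv (pieces (nbwLaw d) c) (convPow (tau d p 0) c.length) x := by
  have hp' : (p : ℝ) < criticalProb (zdGraph d) (0 : Site d) := hp
  have hs : Summable fun x => tau d p 0 x := summable_tau_of_lt_criticalProb hd p hp'
  have hsN := summable_nbwLaw_of Q hQ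
  unfold trailRem
  exact latticeConv_mono (summable_pieces hsN c) (summable_convPow_tau hs _)
    (pieces_nonneg trailLaw_nonneg c) (convPow_tau_nonneg p _)
    (pieces_mono trailLaw_nonneg trailLaw_le_nbwLaw hsN c) (fun _ => le_rfl) x

/-- **THE N53 FRAME THEOREM, x-uniform kernel** (cells 8, 11 and 12-as-a-sup of the Stage-1 notebook):
for every composition `c` with `2|c|+1 ≤ d`, `d ≥ 2`, every polynomial family `Q` with
`b_m = polyLaw (Q m)`, every `p < p_c` and EVERY `x`:
`Rem_c(p;x) ≤ Γ̄₂(p)ⁿ · J_n(∏ᵢ Q cᵢ)`, `J_n = nbwJ d n`.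
[cite: FitznerVanDerHofstad2016NoBLE, §5.3.2 (first display) p. 1097; (5.25) p. 1097] -/
theorem isRemKernelConst_nbwJ (c : List ℕ) (hn : 2 * c.length + 1 ≤ d) (hd : 2 ≤ d)
    (hQ : ∀ m (y : Site d), nbwLaw d m y = polyLaw d (Q m) y) :
    IsRemKernelConst d c Set.univ (nbwJ d c.length (c.map Q).prod) := by
  intro p hp x _
  have hd1 : 1 ≤ d := by omega
  have h2 := kernelConvTau_le_nobleSup2_pow_mul_integral' hn hd p hp
    (summable_pieces (summable_nbwLaw_of Q hQ) c) (isZdSymmetric_pieces (isZdSymmetric_nbwLaw_of Q hQ) c) x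
  have h3 : (∫ k, |cosFT (pieces (nbwLaw d) c) k| * Chat d 1 k ^ c.length ∂P d) / (2 * π) ^ d
      = nbwJ d c.length (c.map Q).prod := by
    unfold nbwJ
    congr 1
    refine integral_congr_ae (Eventually.of_forall fun k => ?_)
    simp only [cosFT_pieces_nbwLaw_of Q hQ hd1 c k]
  calc trailRem d p c x
      ≤ latticeConv (pieces (nbwLaw d) c) (convPow (tau d p 0) c.length) x :=
        trailRem_le_nbwConvTau Q hQ hd p hp c x
    _ ≤ nobleSup2 d p ^ c.length *
          ((∫ k, |cosFT (pieces (nbwLaw d) c) k| * Chat d 1 k ^ c.length ∂P d) / (2 * π) ^ d) := h2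
    _ = nobleSup2 d p ^ c.length * nbwJ d c.length (c.map Q).prod := by rw [h3]

/-- **THE N53 FRAME THEOREM, `e₁` kernel** (cell 5; cell 12 only on the unit shell): at a unit vector
`x = eᵢ` the symmetrised factor is `D̂^{(eᵢ)} = D̂`, so
`Rem_c(p;eᵢ) ≤ Γ̄₂(p)ⁿ · J_n((∏ᵢ Q cᵢ)·X/(2d))`.
[cite: FitznerVanDerHofstad2016NoBLE, §5.3.2 (first display) p. 1097; (3.34) p. 1071] -/
theorem isRemKernelConst_nbwJ_single (c : List ℕ) (hn : 2 * c.length + 1 ≤ d) (hd : 2 ≤ d)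
    (hQ : ∀ m (y : Site d), nbwLaw d m y = polyLaw d (Q m) y) :
    IsRemKernelConst d c (Set.range fun i : Fin d => (Pi.single i (1 : ℤ) : Site d))
      (nbwJ d c.length ((c.map Q).prod * Polynomial.C (1 / (2 * (d : ℝ))) * Polynomial.X)) := by
  rintro p hp x ⟨i, rfl⟩
  have hd1 : 1 ≤ d := by omega
  have hd0 : (2 * (d : ℝ)) ≠ 0 := by
    have : (0 : ℝ) < d := by exact_mod_cast (show 0 < d by omega)
    positivity
  have h2 := kernelConvTau_le_nobleSup2_pow_mul_integral hn hd p hp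
    (summable_pieces (summable_nbwLaw_of Q hQ) c) (isZdSymmetric_pieces (isZdSymmetric_nbwLaw_of Q hQ) c)
    (Pi.single i (1 : ℤ))
  have h3 : (∫ k, (|cosFT (pieces (nbwLaw d) c) k| * |DhatSym d (Pi.single i (1 : ℤ)) k|)
        * Chat d 1 k ^ c.length ∂P d) / (2 * π) ^ d
      = nbwJ d c.length ((c.map Q).prod * Polynomial.C (1 / (2 * (d : ℝ))) * Polynomial.X) := by
    rw [nbwJ_e1_kernel]
    congr 1
    refine integral_congr_ae (Eventually.of_forall fun k => ?_)
    have hk : (1 / (2 * (d : ℝ))) * (2 * (d : ℝ) * Dhat d k) = Dhat d k := by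
      rw [one_div, inv_mul_cancel_left₀ hd0]
    show |cosFT (pieces (nbwLaw d) c) k| * |DhatSym d (Pi.single i (1 : ℤ)) k| * Chat d 1 k ^ c.length
      = |Polynomial.eval (2 * (d : ℝ) * Dhat d k) (c.map Q).prod
          * (1 / (2 * (d : ℝ)) * (2 * (d : ℝ) * Dhat d k))| * Chat d 1 k ^ c.length
    rw [cosFT_pieces_nbwLaw_of Q hQ hd1 c k, DhatSym_single, hk, abs_mul]
  calc trailRem d p c (Pi.single i 1)
      ≤ latticeConv (pieces (nbwLaw d) c) (convPow (tau d p 0) c.length) (Pi.single i 1) :=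
        trailRem_le_nbwConvTau Q hQ hd p hp c _
    _ ≤ nobleSup2 d p ^ c.length *
          ((∫ k, (|cosFT (pieces (nbwLaw d) c) k| * |DhatSym d (Pi.single i (1 : ℤ)) k|)
            * Chat d 1 k ^ c.length ∂P d) / (2 * π) ^ d) := h2
    _ = _ := by rw [h3]

end Frame

end Literature.Probability.FitznerVanDerHofstad2017

end
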